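import Summits.QuantumFields.BalabanUV.T4Continuum.Support.SmallFieldDomainsRowSum
import Summits.QuantumFields.BalabanUV.T4Continuum.Support.SmallFieldDomainsContour

/-!
# T⁴ programme, SUBSTRATE — `Support/SmallFieldDomainsDensity`: CONFINEMENT OF THE `d_Ω`-BALLS of a big-block domain sequence (index window and
# `ℓ¹`-radius of `{y : d_Ω(x, y) < B}`) and the LEVEL-WISE LATTICE COUNT in a box — the two counting tools behind the multi-layer count of
# `Support/SmallFieldDomainsDensityRowSum` (LIBRARY W-11 → row L-B10 «multi-layer count ∕ confinement of d_Ω-balls»; typed: typer ruling (λ1) l.17442;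
# C-REQ-1 of `substrate/p4/LIBRARY-SURVEY-p4.md`; [Balaban1984PropagatorsII] (2.56)–(2.59) for the cell's reading of (2.46))

Audit cell `pub-balaban`, SUBSTRATE cell seat p4 (gen 3); same namespace as `Support/SmallFieldDomains{,Metric,MetricSep,Contour}` (`BigDomainSeq`, `ptIndex`,
`IsPath`/`pathEnd`/`pathCost`/`pathStarts`/`msDist`/`layerWeight`/`msDistΩ`, `layerPiece`, `crossing_le_pathCost_layerPiece`, `mul_le_pathCost_of_starts`,
`mem_of_ptIndex_pos`); `IsLevel` of `Literature/…/B8ConstraintBonds`, `l1` of `…/B7Prop1Explicit` BY NAME (nothing restated).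

WHAT IS PRINTED (documentation; nothing asserted).  [Balaban1984PropagatorsII] Lemma 2.1 p. 234 (2.61) *"sup_{y∈𝔅} Σ_{y′∈𝔅} e^{−αδ₀d(y,y′)} ≦ c₁(α)"*,
proved on pp. 231–233 by counting, for a fixed `y`, the points `y′ ∈ Λ_{j′}` at multiscale distance `≤ n` ((2.56)–(2.59)).  THE CELL'S READING (MAP §O1
(2.46)′): the distance is the fine-path distance `msDistΩ` with weights `(s ι(a))⁻¹`, geometric scales `s i = c·L^i`; `𝔅` = the lattice representatives
(points `y` that are level-`ι(y)` lattice points, cf. `SmallFieldDomainsContourGap.repPt`).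
WHAT THIS FILE PROVIDES (all `[folklore]`; `R·M₁ > 0`, `L ≥ 1`, `c > 0` throughout):
 * §1 PATHS: `exists_prefix_of_mem` (prefix to a visited point, no larger cost), `mem_pathStarts`, `sum_crossings_le_pathCost` (the crossings paid by ONE
   path from `x ∉ Ω_{j+1}` into `Ω_{j′}` — the inner estimate of `MetricSep.sum_crossings_le_msDistΩ`), `sum_crossings_geometric` (each crossing costs
   `R·M₁/(2c)`), **`ptIndex_le_of_mem_path`**: every point visited by a path of cost `≤ B` from `x` has index `≤ ι x + 1 + 2cB/(R·M₁)`, and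
   **`mul_l1_le_pathCost_of_index_le`**: a path all of whose points have index `≤ m` costs `≥ (s m)⁻¹/2` per bond, hence `≥ (s m)⁻¹/2·|end − x|₁`;
 * §2 CONFINEMENT OF THE BALL `d_Ω(x, ·) < B`: `exists_path_of_msDist_lt` (a path realising a strict upper bound of the infimum), the INDEX WINDOW
   `ptIndex_le_of_msDistΩ_lt` ∕ `…_lt'` ∕ `ptIndex_window_of_msDistΩ_lt` (`|ι y − ι x| ≤ W := 1 + ⌊2cB/(R·M₁)⌋`), and the `ℓ¹`-RADIUS
   **`l1_le_of_msDistΩ_lt`**: `|y − x|₁ ≤ 2cB·L^{ι x + W}`;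
 * §3 THE LEVEL-WISE LATTICE COUNT: `card_Icc_ediv_le` (one dimension) and **`card_filter_isLevel_box_le`**: in any finite set, the level-`i` lattice points
   of a sup-box of radius `N` number at most `(2N/L^i + 2)^d` (injection by the cube index into a box of indices).
HONEST FRAMING (T4-DAG p. 1).  Metric GEOMETRY and COUNTING on `ℤ^d`; no configuration, no estimate of any NE row; spine 0/9 unchanged; NOT infinite volume,
NOT a mass gap, NOT Clay.  HONEST DEPENDENCY: continuum YM on T⁴ ⇐ BetaPertH ∧ nine spine estimates (0/9 proved); BetaPertH ⇐ (D1) ∧ (D4) ∧ CAP+tail; G-an2-4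
gates asym, D1 and NE2/3/4.  No `sorry`.
-/

noncomputable section

open scoped BigOperators

namespace Summit.QuantumFields.BalabanUV.T4Continuum.SmallFieldDomains

open Literature.MathematicalPhysics.QuantumFieldTheory.Balaban1983to89.B14DomainGeom
open Literature.MathematicalPhysics.QuantumFieldTheory.Balaban1983to89.B8ConstraintBonds (IsLevel)
open Literature.MathematicalPhysics.QuantumFieldTheory.Balaban1983to89.B7Prop1Explicit (e l1)

variable {d : ℕ}

/-! ## §1 Prefixes of fine paths and the crossings ALONG A GIVEN PATH -/

section Paths
variable {L M₁ R k : ℕ} {Ω : ℕ → Set (Pt d)} {s : ℕ → ℝ}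

/-- PREFIX TO A VISITED POINT: a path from `x` visiting `z` has a prefix ending at `z`, of no larger cost (non-negative weight). [folklore] -/
theorem exists_prefix_of_mem {w : Pt d → Pt d → ℝ} (hw0 : ∀ a b, 0 ≤ w a b) :
    ∀ (x : Pt d) (l : List (Pt d)), IsPath x l → ∀ z ∈ l,
      ∃ p, IsPath x p ∧ pathEnd x p = z ∧ pathCost w x p ≤ pathCost w x l
  | _, [], _, _, hz => absurd hz List.not_mem_nil
  | x, y :: l, h, z, hz => by
    obtain ⟨hxy, hl⟩ := h
    rcases List.mem_cons.mp hz with hzy | hz'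
    · subst hzy
      refine ⟨[z], ⟨hxy, trivial⟩, rfl, ?_⟩
      rw [pathCost_cons, pathCost_cons, pathCost_nil, add_zero]
      exact le_add_of_nonneg_right (pathCost_nonneg hw0 _ l)
    · obtain ⟨p, hp, hpe, hpc⟩ := exists_prefix_of_mem hw0 y l hl z hz'
      refine ⟨y :: p, ⟨hxy, hp⟩, by simpa using hpe, ?_⟩
      rw [pathCost_cons, pathCost_cons]
      exact add_le_add le_rfl hpc

/-- A START point of a bond of the path `(x, l)` is `x` or a point of `l`. [folklore] -/
theorem mem_pathStarts : ∀ {x : Pt d} {l : List (Pt d)} {a : Pt d}, a ∈ pathStarts x l → a = x ∨ a ∈ l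
  | _, [], _, ha => absurd ha List.not_mem_nil
  | x, y :: l, a, ha => by
    rw [pathStarts_cons, List.mem_cons] at ha
    rcases ha with h | h
    · exact Or.inl h
    · rcases mem_pathStarts h with h' | h'
      · exact Or.inr (by rw [h']; exact List.mem_cons_self)
      · exact Or.inr (List.mem_cons_of_mem y h')

/-- THE CROSSINGS ALONG A PATH (the inner estimate of `SmallFieldDomainsMetricSep.sum_crossings_le_msDistΩ`, stated for ONE path and with the
start only asked to lie OUTSIDE `Ω_{j+1}`): a fine path from `x ∉ Ω_{j+1}` ending in `Ω_{j′}` pays every crossing strictly between,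
`Σ_{i ∈ (j, j′)} (R·M₁·L^i)·(s i)⁻¹/2 ≤ cost`. [folklore] -/
theorem sum_crossings_le_pathCost (hΩ : BigDomainSeq L M₁ R k Ω) (hs : ∀ j, 0 < s j) {j j' : ℕ} {x : Pt d} {l : List (Pt d)}
    (hl : IsPath x l) (hx : x ∉ Ω (j + 1)) (hend : pathEnd x l ∈ Ω j') :
    ∑ i ∈ Finset.Ioo j j', (s i)⁻¹ / 2 * ((R * M₁ * L ^ i : ℕ) : ℝ) ≤ pathCost (layerWeight s k Ω) x l := by
  have hpiece : ∀ i ∈ Finset.Ioo j j', (s i)⁻¹ / 2 * ((R * M₁ * L ^ i : ℕ) : ℝ) ≤ pathCost (layerPiece s Ω i) x l := by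
    intro i hi
    rw [Finset.mem_Ioo] at hi
    have hxi : x ∉ Ω i := fun h => hx (hΩ.anti_le (by omega : j + 1 ≤ i) h)
    have hend' : pathEnd x l ∈ Ω (i + 1) := hΩ.anti_le (by omega : i + 1 ≤ j') hend
    exact crossing_le_pathCost_layerPiece hΩ hs i hl hxi hend'
  calc ∑ i ∈ Finset.Ioo j j', (s i)⁻¹ / 2 * ((R * M₁ * L ^ i : ℕ) : ℝ)
      ≤ ∑ i ∈ Finset.Ioo j j', pathCost (layerPiece s Ω i) x l := Finset.sum_le_sum hpiece
    _ = pathCost (fun a b => ∑ i ∈ Finset.Ioo j j', layerPiece s Ω i a b) x l := (pathCost_finset_sum _ _ x l).symm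
    _ ≤ pathCost (layerWeight s k Ω) x l := pathCost_mono (sum_layerPiece_le_layerWeight hΩ hs _) x l

/-- For GEOMETRIC scales `s i = c·L^i` every crossing costs the same amount `R·M₁/(2c)`. [folklore] -/
theorem sum_crossings_geometric {c : ℝ} (hc : 0 < c) (hL : 1 ≤ L) (hsc : ∀ i, s i = c * (L : ℝ) ^ i) (I : Finset ℕ) :
    ∑ i ∈ I, (s i)⁻¹ / 2 * ((R * M₁ * L ^ i : ℕ) : ℝ) = (I.card : ℝ) * ((R * M₁ : ℝ) / (2 * c)) := by
  have hL0 : (0 : ℝ) < L := by exact_mod_cast (lt_of_lt_of_le Nat.zero_lt_one hL)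
  have hterm : ∀ i ∈ I, (s i)⁻¹ / 2 * ((R * M₁ * L ^ i : ℕ) : ℝ) = (R * M₁ : ℝ) / (2 * c) := by
    intro i _
    rw [hsc i]
    have hLi : (L : ℝ) ^ i ≠ 0 := pow_ne_zero i hL0.ne'
    push_cast
    field_simp
  rw [Finset.sum_congr rfl hterm, Finset.sum_const, nsmul_eq_mul]

/-- **INDEX CONFINEMENT ALONG CHEAP PATHS**: for a big-block domain sequence with geometric scales `s i = c·L^i` and `R·M₁ > 0`, every point `z`
visited by a fine path from `x` of cost `≤ B` has index `ι z ≤ ι x + 1 + 2cB/(R·M₁)` (the prefix up to `z` crosses the layers `ι x + 1, …, ι z − 1`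
completely, each at the price `R·M₁/(2c)`). [folklore] -/
theorem ptIndex_le_of_mem_path (hΩ : BigDomainSeq L M₁ R k Ω) {c : ℝ} (hc : 0 < c) (hL : 1 ≤ L) (hsc : ∀ i, s i = c * (L : ℝ) ^ i)
    (hRM : (0 : ℝ) < R * M₁) {x : Pt d} {l : List (Pt d)} (hl : IsPath x l) {B : ℝ} (hB : pathCost (layerWeight s k Ω) x l ≤ B)
    {z : Pt d} (hz : z ∈ l) : (ptIndex k Ω z : ℝ) ≤ ptIndex k Ω x + 1 + 2 * c * B / (R * M₁) := by
  have hs : ∀ i, 0 < s i := fun i => by rw [hsc i]; positivity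
  have hw0 := layerWeight_nonneg s k Ω hs
  have hB0 : 0 ≤ B := (pathCost_nonneg hw0 x l).trans hB
  have hfrac : 0 ≤ 2 * c * B / (R * M₁) := by positivity
  rcases Nat.lt_or_ge (ptIndex k Ω x + 1) (ptIndex k Ω z) with hlt | hge
  · -- the prefix up to `z` crosses `ι z − ι x − 1 ≥ 1` layers
    obtain ⟨p, hp, hpe, hpc⟩ := exists_prefix_of_mem hw0 x l hl z hz
    have hxout : x ∉ Ω (ptIndex k Ω x + 1) := not_mem_ptIndex_succ hΩ x
    have hzin : pathEnd x p ∈ Ω (ptIndex k Ω z) := by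
      rw [hpe]; exact mem_of_ptIndex_pos hΩ (by omega) le_rfl
    have hsum := sum_crossings_le_pathCost hΩ hs hp hxout hzin
    rw [sum_crossings_geometric hc hL hsc, Nat.card_Ioo] at hsum
    -- `(ι z − ι x − 1)·(R M₁/(2c)) ≤ B`
    have h1 : ((ptIndex k Ω z - (ptIndex k Ω x + 1) : ℕ) : ℝ) * ((R * M₁ : ℝ) / (2 * c)) ≤ B := hsum.trans (hpc.trans hB)
    have hcast : ((ptIndex k Ω z - (ptIndex k Ω x + 1) : ℕ) : ℝ) = (ptIndex k Ω z : ℝ) - ptIndex k Ω x - 1 := by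
      rw [Nat.cast_sub hlt.le]; push_cast; ring
    rw [hcast] at h1
    -- divide by `R M₁/(2c) > 0`
    have hD : 0 < (R * M₁ : ℝ) / (2 * c) := by positivity
    have h2 : (ptIndex k Ω z : ℝ) - ptIndex k Ω x - 1 ≤ B / ((R * M₁ : ℝ) / (2 * c)) := by
      rw [le_div_iff₀ hD]; exact h1
    have h3 : B / ((R * M₁ : ℝ) / (2 * c)) = 2 * c * B / (R * M₁) := by
      field_simp
    linarith [h2, h3.le, h3.ge]
  · have : (ptIndex k Ω z : ℝ) ≤ ptIndex k Ω x + 1 := by exact_mod_cast hge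
    linarith

/-- **`ℓ¹` CONFINEMENT**: if `x` and every point of a fine path from `x` have index `≤ m`, the path costs at least `(s m)⁻¹/2` per bond (positive
non-decreasing scales), hence `(s m)⁻¹/2 · |end − x|₁ ≤ cost`. [folklore] -/
theorem mul_l1_le_pathCost_of_index_le (hs : ∀ j, 0 < s j) (hmono : Monotone s) {m : ℕ} {x : Pt d} {l : List (Pt d)} (hl : IsPath x l)
    (hx : ptIndex k Ω x ≤ m) (hidx : ∀ z ∈ l, ptIndex k Ω z ≤ m) :
    (s m)⁻¹ / 2 * (l1 (pathEnd x l - x) : ℝ) ≤ pathCost (layerWeight s k Ω) x l := by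
  have hstarts : ∀ a ∈ pathStarts x l, a ∈ {a : Pt d | ptIndex k Ω a ≤ m} := by
    intro a ha
    rcases mem_pathStarts ha with h | h
    · rw [h]; exact hx
    · exact hidx a h
  have hwc : ∀ a b : Pt d, a ∈ {a : Pt d | ptIndex k Ω a ≤ m} → Adj a b → (s m)⁻¹ / 2 ≤ layerWeight s k Ω a b := by
    intro a b ha _
    have h1 : (s m)⁻¹ ≤ (s (ptIndex k Ω a))⁻¹ := inv_anti₀ (hs _) (hmono ha)
    have h2 : 0 ≤ (s (ptIndex k Ω b))⁻¹ := inv_nonneg.mpr (hs _).le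
    unfold layerWeight
    linarith
  have hlen := mul_le_pathCost_of_starts hwc x l hl hstarts
  have hl1 : (l1 (pathEnd x l - x) : ℝ) ≤ (l.length : ℝ) := by exact_mod_cast l1_le_length x l hl
  have hpos : 0 ≤ (s m)⁻¹ / 2 := div_nonneg (inv_nonneg.mpr (hs m).le) (by norm_num)
  exact (mul_le_mul_of_nonneg_left hl1 hpos).trans hlen

end Paths

/-! ## §2 Confinement of the `d_Ω`-ball: index window and `ℓ¹`-radius -/

section Confinement
variable {L M₁ R k : ℕ} {Ω : ℕ → Set (Pt d)} {s : ℕ → ℝ}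

/-- A path REALISING a strict upper bound of the infimum: `d_w(x, y) < B` ⇒ some fine path from `x` to `y` costs `< B`. [folklore] -/
theorem exists_path_of_msDist_lt {w : Pt d → Pt d → ℝ} {x y : Pt d} {B : ℝ} (h : msDist w x y < B) :
    ∃ l, IsPath x l ∧ pathEnd x l = y ∧ pathCost w x l < B := by
  obtain ⟨c, ⟨l, hl, he, hc⟩, hcB⟩ := exists_lt_of_csInf_lt (costSet_nonempty w x y) h
  exact ⟨l, hl, he, hc ▸ hcB⟩

/-- The endpoint of a non-trivial path is one of its points; in general it is `x` or a point of `l`. [folklore] -/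
theorem pathEnd_eq_or_mem : ∀ (x : Pt d) (l : List (Pt d)), pathEnd x l = x ∨ pathEnd x l ∈ l
  | _, [] => Or.inl rfl
  | x, y :: l => by
    rw [pathEnd_cons]
    rcases pathEnd_eq_or_mem y l with h | h
    · exact Or.inr (by rw [h]; exact List.mem_cons_self)
    · exact Or.inr (List.mem_cons_of_mem y h)

/-- **THE INDEX WINDOW, upper half**: `d_Ω(x, y) < B` ⇒ `ι y ≤ ι x + 1 + 2cB/(R·M₁)` (geometric scales, `R·M₁ > 0`). [folklore] -/
theorem ptIndex_le_of_msDistΩ_lt (hΩ : BigDomainSeq L M₁ R k Ω) {c : ℝ} (hc : 0 < c) (hL : 1 ≤ L) (hsc : ∀ i, s i = c * (L : ℝ) ^ i)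
    (hRM : (0 : ℝ) < R * M₁) {x y : Pt d} {B : ℝ} (hB : msDistΩ s k Ω x y < B) :
    (ptIndex k Ω y : ℝ) ≤ ptIndex k Ω x + 1 + 2 * c * B / (R * M₁) := by
  obtain ⟨l, hl, he, hcost⟩ := exists_path_of_msDist_lt hB
  rcases pathEnd_eq_or_mem x l with h | h
  · -- trivial path: `y = x`
    rw [← he, h]
    have hB0 : 0 ≤ B := by
      have hs : ∀ i, 0 < s i := fun i => by rw [hsc i]; positivity
      exact ((pathCost_nonneg (layerWeight_nonneg s k Ω hs) x l).trans hcost.le)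
    have : 0 ≤ 2 * c * B / (R * M₁) := by positivity
    linarith
  · rw [← he]
    exact ptIndex_le_of_mem_path hΩ hc hL hsc hRM hl hcost.le h

/-- **THE INDEX WINDOW, lower half** (symmetry of `d_Ω`): `d_Ω(x, y) < B` ⇒ `ι x ≤ ι y + 1 + 2cB/(R·M₁)`. [folklore] -/
theorem ptIndex_le_of_msDistΩ_lt' (hΩ : BigDomainSeq L M₁ R k Ω) {c : ℝ} (hc : 0 < c) (hL : 1 ≤ L) (hsc : ∀ i, s i = c * (L : ℝ) ^ i)
    (hRM : (0 : ℝ) < R * M₁) {x y : Pt d} {B : ℝ} (hB : msDistΩ s k Ω x y < B) :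
    (ptIndex k Ω x : ℝ) ≤ ptIndex k Ω y + 1 + 2 * c * B / (R * M₁) := by
  have hs : ∀ i, 0 < s i := fun i => by rw [hsc i]; positivity
  rw [msDistΩ_comm s k Ω hs] at hB
  exact ptIndex_le_of_msDistΩ_lt hΩ hc hL hsc hRM hB

/-- The index window in NATURAL NUMBERS: with `W = 1 + ⌊2cB/(R·M₁)⌋`, `d_Ω(x, y) < B` ⇒ `ι y ≤ ι x + W` and `ι x ≤ ι y + W`. [folklore] -/
theorem ptIndex_window_of_msDistΩ_lt (hΩ : BigDomainSeq L M₁ R k Ω) {c : ℝ} (hc : 0 < c) (hL : 1 ≤ L) (hsc : ∀ i, s i = c * (L : ℝ) ^ i)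
    (hRM : (0 : ℝ) < R * M₁) {x y : Pt d} {B : ℝ} (hB0 : 0 ≤ B) (hB : msDistΩ s k Ω x y < B) :
    ptIndex k Ω y ≤ ptIndex k Ω x + (1 + ⌊2 * c * B / (R * M₁)⌋₊) ∧
      ptIndex k Ω x ≤ ptIndex k Ω y + (1 + ⌊2 * c * B / (R * M₁)⌋₊) := by
  have ht : 0 ≤ 2 * c * B / (R * M₁) := by positivity
  have key : ∀ {a b : ℕ}, (a : ℝ) ≤ b + 1 + 2 * c * B / (R * M₁) → a ≤ b + (1 + ⌊2 * c * B / (R * M₁)⌋₊) := by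
    intro a b h
    rcases Nat.lt_or_ge (b + 1) a with hlt | hge
    · have h1 : ((a - (b + 1) : ℕ) : ℝ) ≤ 2 * c * B / (R * M₁) := by
        rw [Nat.cast_sub hlt.le]; push_cast; linarith
      have h2 : a - (b + 1) ≤ ⌊2 * c * B / (R * M₁)⌋₊ := Nat.le_floor h1
      omega
    · omega
  exact ⟨key (ptIndex_le_of_msDistΩ_lt hΩ hc hL hsc hRM hB), key (ptIndex_le_of_msDistΩ_lt' hΩ hc hL hsc hRM hB)⟩

/-- **THE `ℓ¹`-RADIUS OF THE `d_Ω`-BALL**: `d_Ω(x, y) < B` ⇒ `|y − x|₁ ≤ 2cB·L^m` with `m = ι x + 1 + ⌊2cB/(R·M₁)⌋` (every point of a path of cost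
`< B` has index `≤ m`, so every bond costs `≥ (cL^m)⁻¹/2`). [folklore] -/
theorem l1_le_of_msDistΩ_lt (hΩ : BigDomainSeq L M₁ R k Ω) {c : ℝ} (hc : 0 < c) (hL : 1 ≤ L) (hsc : ∀ i, s i = c * (L : ℝ) ^ i)
    (hRM : (0 : ℝ) < R * M₁) {x y : Pt d} {B : ℝ} (hB0 : 0 ≤ B) (hB : msDistΩ s k Ω x y < B) :
    (l1 (y - x) : ℝ) ≤ 2 * c * B * (L : ℝ) ^ (ptIndex k Ω x + (1 + ⌊2 * c * B / (R * M₁)⌋₊)) := by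
  set m : ℕ := ptIndex k Ω x + (1 + ⌊2 * c * B / (R * M₁)⌋₊) with hm
  have hs : ∀ i, 0 < s i := fun i => by rw [hsc i]; positivity
  have hLr : (1 : ℝ) ≤ L := by exact_mod_cast hL
  have hmono : Monotone s := fun a b hab => by
    rw [hsc, hsc]; exact mul_le_mul_of_nonneg_left (pow_le_pow_right₀ hLr hab) hc.le
  obtain ⟨l, hl, he, hcost⟩ := exists_path_of_msDist_lt hB
  -- every visited point has index `≤ m`
  have ht : 0 ≤ 2 * c * B / (R * M₁) := by positivity
  have hidx : ∀ z ∈ l, ptIndex k Ω z ≤ m := by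
    intro z hz
    have h := ptIndex_le_of_mem_path hΩ hc hL hsc hRM hl hcost.le hz
    rcases Nat.lt_or_ge (ptIndex k Ω x + 1) (ptIndex k Ω z) with hlt | hge
    · have h1 : ((ptIndex k Ω z - (ptIndex k Ω x + 1) : ℕ) : ℝ) ≤ 2 * c * B / (R * M₁) := by
        rw [Nat.cast_sub hlt.le]; push_cast; linarith
      have h2 := Nat.le_floor h1
      omega
    · omega
  have hx : ptIndex k Ω x ≤ m := by omega
  have hconf := mul_l1_le_pathCost_of_index_le (k := k) (Ω := Ω) hs hmono hl hx hidx
  rw [he] at hconf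
  -- `(s m)⁻¹/2 · |y − x|₁ ≤ cost < B`
  have h1 : (s m)⁻¹ / 2 * (l1 (y - x) : ℝ) ≤ B := hconf.trans hcost.le
  have hsm : 0 < s m := hs m
  have h2 : (l1 (y - x) : ℝ) ≤ 2 * B * s m := by
    have := mul_le_mul_of_nonneg_left h1 (by positivity : (0 : ℝ) ≤ 2 * s m)
    have e1 : 2 * s m * ((s m)⁻¹ / 2 * (l1 (y - x) : ℝ)) = (l1 (y - x) : ℝ) := by field_simp
    rw [e1] at this
    linarith
  rw [hsc m] at h2
  calc (l1 (y - x) : ℝ) ≤ 2 * B * (c * (L : ℝ) ^ m) := h2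
    _ = 2 * c * B * (L : ℝ) ^ m := by ring

end Confinement

/-! ## §3 Counting the lattice points of one level in a box -/

section Count
variable {L : ℕ}

/-- ONE-DIMENSIONAL INDEX COUNT: for `P > 0` the integers `⌊(t − N)/P⌋, …, ⌊(t + N)/P⌋` number at most `2N/P + 2`. [folklore] -/
theorem card_Icc_ediv_le {P : ℤ} (hP : 0 < P) (t : ℤ) (N : ℕ) :
    ((Finset.Icc ((t - N) / P) ((t + N) / P)).card : ℝ) ≤ 2 * (N : ℝ) / (P : ℝ) + 2 := by
  rw [Int.card_Icc]
  set a : ℤ := (t - N) / P with ha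
  set b : ℤ := (t + N) / P with hb
  have hab : a ≤ b := Int.ediv_le_ediv hP (by omega)
  have hnn : 0 ≤ b + 1 - a := by omega
  have hcast : (((b + 1 - a).toNat : ℕ) : ℝ) = ((b + 1 - a : ℤ) : ℝ) := by exact_mod_cast Int.toNat_of_nonneg hnn
  rw [hcast]
  -- `b·P ≤ t + N` and `t − N < (a + 1)·P`
  have h1 : b * P ≤ t + N := Int.ediv_mul_le _ hP.ne'
  have h2 : t - N < (a + 1) * P := Int.lt_ediv_add_one_mul_self _ hP
  have h3 : (b - a - 1) * P < 2 * N := by nlinarith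
  have hPr : (0 : ℝ) < P := by exact_mod_cast hP
  have h4 : ((b : ℝ) - a - 1) * P < 2 * N := by exact_mod_cast h3
  have h5 : (b : ℝ) - a - 1 < 2 * (N : ℝ) / P := by rw [lt_div_iff₀ hPr]; exact h4
  push_cast
  linarith

/-- **LATTICE POINTS OF LEVEL `i` IN A SUP-BOX**: among any finite set, the points `y` with `L^i ∣ y` coordinatewise and `|y_μ − x_μ| ≤ N` (all `μ`)
number at most `(2N/L^i + 2)^d` (inject by the cube index `y ↦ y/L^i` into a box of indices; `L ≥ 1`). [folklore] -/
theorem card_filter_isLevel_box_le (hL : 1 ≤ L) (i : ℕ) (x : Pt d) (N : ℕ) (S : Finset (Pt d))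
    [DecidablePred (fun y : Pt d => IsLevel L i y ∧ ∀ μ, |y μ - x μ| ≤ (N : ℤ))] :
    ((S.filter (fun y => IsLevel L i y ∧ ∀ μ, |y μ - x μ| ≤ (N : ℤ))).card : ℝ) ≤ (2 * (N : ℝ) / (L : ℝ) ^ i + 2) ^ d := by
  classical
  have hL0 : 0 < L := lt_of_lt_of_le Nat.zero_lt_one hL
  set P : ℤ := (L : ℤ) ^ i with hP
  have hP0 : 0 < P := by rw [hP]; exact_mod_cast pow_pos hL0 i
  set T : Finset (Pt d) := S.filter (fun y => IsLevel L i y ∧ ∀ μ, |y μ - x μ| ≤ (N : ℤ)) with hT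
  set box : Finset (Fin d → ℤ) := Fintype.piFinset (fun μ => Finset.Icc ((x μ - N) / P) ((x μ + N) / P)) with hbox
  have hidx : ∀ (y : Pt d) (μ : Fin d), cubeIdx (L ^ i) y μ = y μ / P := fun y μ => by simp [cubeIdx, hP]
  have hmaps : ∀ y ∈ T, cubeIdx (L ^ i) y ∈ box := by
    intro y hy
    rw [hT, Finset.mem_filter] at hy
    obtain ⟨-, -, hwithin⟩ := hy
    rw [hbox, Fintype.mem_piFinset]
    intro μ
    rw [Finset.mem_Icc, hidx]
    have hw := hwithin μ
    rw [abs_le] at hw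
    exact ⟨Int.ediv_le_ediv hP0 (by linarith), Int.ediv_le_ediv hP0 (by linarith)⟩
  have hinj : Set.InjOn (cubeIdx (L ^ i)) (T : Set (Pt d)) := by
    intro y hy y' hy' hyy
    rw [Finset.mem_coe, hT, Finset.mem_filter] at hy hy'
    funext μ
    have hq := congrFun hyy μ
    rw [hidx, hidx] at hq
    have e1 : P * (y μ / P) = y μ := Int.mul_ediv_cancel' (by have := hy.2.1 μ; rw [hP]; exact this)
    have e2 : P * (y' μ / P) = y' μ := Int.mul_ediv_cancel' (by have := hy'.2.1 μ; rw [hP]; exact this)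
    rw [← e1, ← e2, hq]
  have hcard : T.card ≤ box.card := Finset.card_le_card_of_injOn _ hmaps hinj
  have hboxcard : (box.card : ℝ) ≤ (2 * (N : ℝ) / (L : ℝ) ^ i + 2) ^ d := by
    rw [hbox, Fintype.card_piFinset, Nat.cast_prod]
    have hPr : ((P : ℤ) : ℝ) = (L : ℝ) ^ i := by rw [hP]; push_cast; ring
    calc ∏ μ : Fin d, ((Finset.Icc ((x μ - N) / P) ((x μ + N) / P)).card : ℝ)
        ≤ ∏ _μ : Fin d, (2 * (N : ℝ) / (L : ℝ) ^ i + 2) :=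
          Finset.prod_le_prod (fun μ _ => Nat.cast_nonneg _) fun μ _ => by rw [← hPr]; exact card_Icc_ediv_le hP0 (x μ) N
      _ = (2 * (N : ℝ) / (L : ℝ) ^ i + 2) ^ d := by rw [Finset.prod_const, Finset.card_univ, Fintype.card_fin]
  calc (T.card : ℝ) ≤ (box.card : ℝ) := by exact_mod_cast hcard
    _ ≤ _ := hboxcard

end Count

end Summit.QuantumFields.BalabanUV.T4Continuum.SmallFieldDomains

end
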